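import Summits.AnomalousDissipation.AnomalousDissipation.Theorems.SolenoidalFractalHomogenisationLagrangianStepSidebandSlot
import HarnessLib

/-!
# K1L_D `stub_D1_V0thg` (stmt-AnomalousDissipation-27980), R3′ lane «SidebandTailCrushing» (tenure D28-16 (3)) — file F3:
# LADDER VOCABULARY on the truncated sideband space (shared definitions; `--supports stmt-AnomalousDissipation-27980 --as helper`)

Summits-side DEFINITIONS file of route `SolenoidalFractalHomogenisation` (prover seat `ad-k1l-cellLawV-w1` g10; plan memo
`Cruxes/LagrangianRenormalisationStepDesign/Lines/onelevel-vtheta-R3-plan.md` §3–§4).  Objects of `…SidebandDefs` (definition of record D26-3) only.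
During slot `i` (all other envelopes off) the augmented truncated generator splits as `gen t = envᵢ(t) • hopL − dampL` (`gen_eq_of_slot`):
* `diagL R w` — the fibrewise multiplication by a real weight `w z` (a bounded, symmetric, site-diagonal operator); `siteIndex m z = ⌊z·m/|m|²⌋ + 1/2`
  — the HALF-INTEGER SITE INDEX along the `m`-ladders (Euclidean integer division; `siteIndex m (z + m) = siteIndex m z + 1`, sign = sign of `z·m`);
  `indexL R m := diagL R (siteIndex m)` — the operator `K` of the hypocoercivity lemma `LadderCrush.hypocoercive_decay'`;
* `linkBlock W₁ R i z` — the bracket `P_z(αᵢ P_{z−mᵢ} y_{z−mᵢ} + ᾱᵢ P_{z+mᵢ} y_{z+mᵢ})` of `Sideband.genComp`; `hopL W₁ R i` — the slot's LINK OPERATOR AT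
  UNIT ENVELOPE, `(hopL y)_z = −2πi(êᵢ·z) • linkBlock … z y` (skew: `Sideband.sum_re_inner_link_eq_zero`), so that the links of `genComp` during slot `i`
  are `envᵢ(t) • hopL`;
* `dampL 𝔸 γ₁ R` — the DAMPING `(dampL y)_z = 4π² P_z T_{𝔸ᵀ}(z) P_z y_z + γ₁ (y_z − P_z y_z)` (= `−blockGen` fibrewise);
* `ladder z₀ m = {z₀ + k•m}` and `ladderSub R L` — the REAL subspace of transversal states supported on a set `L` of lattice points (the `V` of the lemma).
Definitions + unfolding lemmas + the slot identity; no theorem of substance, no named fact, no sorry.  NOT a proof of anything; rung F-D1.A0 infrastructure.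
-/

set_option linter.dupNamespace false -- single-conjunct summit: `Summit.AnomalousDissipation.AnomalousDissipation.…` is the mandated namespace

noncomputable section

namespace Summit.AnomalousDissipation.AnomalousDissipation.Theorems.SolenoidalFractalHomogenisation.LagrangianStep.Sideband

open Set Complex
open scoped InnerProductSpace
open Literature.Analysis Literature.Analysis.FunctionSpaces Literature.Analysis.FunctionSpaces.Torus
open Literature.Analysis.FluidPDE Literature.Analysis.FluidPDE.Torus Literature.Analysis.FluidPDE.LatticeShear
open Summit.AnomalousDissipation.AnomalousDissipation.Theorems.SolenoidalFractalHomogenisation.LagrangianStep.CellChain (linkCoeff)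

variable {k₀ : ℕ}

/-! ## §1 Site-diagonal real weights and the half-integer site index -/

/-- The integer dot product `z·m = Σᵢ zᵢ mᵢ` on `ℤ³`. [folklore] -/
def zdot (z m : Fin 3 → ℤ) : ℤ := ∑ i, z i * m i

/-- Unfolding `zdot`. [folklore] -/
theorem zdot_def (z m : Fin 3 → ℤ) : zdot z m = ∑ i, z i * m i := rfl

/-- `zdot` is additive in the first slot. [folklore] -/
theorem zdot_add_left (z w m : Fin 3 → ℤ) : zdot (z + w) m = zdot z m + zdot w m := by
  simp only [zdot, Pi.add_apply, add_mul, Finset.sum_add_distrib]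

/-- `zdot` cast to `ℝ` is the real dot product of the lattice vectors. [folklore] -/
theorem cast_zdot (z m : Fin 3 → ℤ) : (zdot z m : ℝ) = ∑ i, (z i : ℝ) * m i := by
  simp only [zdot, Int.cast_sum, Int.cast_mul]

/-- **The half-integer site index along the `m`-ladders**: `κ_m(z) = ⌊z·m / m·m⌋ + 1/2` (Euclidean integer division by `|m|² > 0`; for `m = 0` junk value
`1/2`).  It increases by `1` along the ladder (`siteIndex_add_self`) and has the sign of `z·m`; the two sites adjacent to the foot of the perpendicular from
the origin get `∓1/2`. [cite: BedrossianCotiZelati2017, §2 (hypocoercivity functional: the weight ∂_y)] -/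
def siteIndex (m z : Fin 3 → ℤ) : ℝ := ((zdot z m / zdot m m : ℤ) : ℝ) + 1 / 2

/-- Unfolding `siteIndex`. [cite: BedrossianCotiZelati2017, §2] -/
theorem siteIndex_def (m z : Fin 3 → ℤ) : siteIndex m z = ((zdot z m / zdot m m : ℤ) : ℝ) + 1 / 2 := rfl

/-- `κ_m(z + m) = κ_m(z) + 1` (`m ≠ 0`). [cite: BedrossianCotiZelati2017, §2] -/
theorem siteIndex_add_self {m : Fin 3 → ℤ} (hm : zdot m m ≠ 0) (z : Fin 3 → ℤ) : siteIndex m (z + m) = siteIndex m z + 1 := by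
  rw [siteIndex, siteIndex, zdot_add_left, Int.add_ediv_of_dvd_right (dvd_refl _), Int.ediv_self hm]
  push_cast; ring

/-- `κ_m(z − m) = κ_m(z) − 1` (`m ≠ 0`). [cite: BedrossianCotiZelati2017, §2] -/
theorem siteIndex_sub_self {m : Fin 3 → ℤ} (hm : zdot m m ≠ 0) (z : Fin 3 → ℤ) : siteIndex m (z - m) = siteIndex m z - 1 := by
  have h := siteIndex_add_self hm (z - m)
  rw [sub_add_cancel] at h
  linarith

/-- **Fibrewise multiplication by a real weight** `w : ℤ³ → ℝ`: `(diagL R w y)_z = w(z) • y_z`. [folklore] -/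
def diagL (R : ℕ) (w : (Fin 3 → ℤ) → ℝ) : Space R →L[ℂ] Space R :=
  ((PiLp.continuousLinearEquiv 2 ℂ (fun _ : box R => EuclideanSpace ℂ (Fin 3))).symm :
      (box R → EuclideanSpace ℂ (Fin 3)) →L[ℂ] Space R).comp
    (ContinuousLinearMap.pi fun z : box R => ((w z.1 : ℝ) : ℂ) • PiLp.proj 2 (fun _ : box R => EuclideanSpace ℂ (Fin 3)) z)

/-- Components of `diagL`. [folklore] -/
theorem diagL_apply (R : ℕ) (w : (Fin 3 → ℤ) → ℝ) (y : Space R) (z : box R) : diagL R w y z = ((w z.1 : ℝ) : ℂ) • y z := by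
  simp [diagL]

/-- **The site-index operator** `K_m := diagL R (siteIndex m)`. [cite: BedrossianCotiZelati2017, §2 (hypocoercivity functional: the weight ∂_y)] -/
def indexL (R : ℕ) (m : Fin 3 → ℤ) : Space R →L[ℂ] Space R := diagL R (siteIndex m)

/-- Components of `indexL`. [cite: BedrossianCotiZelati2017, §2] -/
theorem indexL_apply (R : ℕ) (m : Fin 3 → ℤ) (y : Space R) (z : box R) : indexL R m y z = ((siteIndex m z.1 : ℝ) : ℂ) • y z :=
  diagL_apply R (siteIndex m) y z

/-! ## §2 The slot's link operator at unit envelope and the damping -/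

/-- **The link bracket of slot `i` at the fibre `z`**: `y ↦ P_z(αᵢ P_{z−mᵢ} y_{z−mᵢ} + ᾱᵢ P_{z+mᵢ} y_{z+mᵢ})` (the bracket of `Sideband.genComp`;
neighbours outside the box read as `0`). [cite: MeshalkinSinai1961, pp. 1700–1705] -/
def linkBlock (W₁ : LatticeWord k₀) (R : ℕ) (i : Fin k₀) (z : box R) : Space R →L[ℂ] EuclideanSpace ℂ (Fin 3) :=
  (transversalProj z.1).comp
    (slotAmp W₁ i • ((transversalProj (z.1 - (W₁.phase i).m)).comp (coordL R (z.1 - (W₁.phase i).m))) +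
      starRingEnd ℂ (slotAmp W₁ i) • ((transversalProj (z.1 + (W₁.phase i).m)).comp (coordL R (z.1 + (W₁.phase i).m))))

/-- Unfolding `linkBlock`. [cite: MeshalkinSinai1961, pp. 1700–1705] -/
theorem linkBlock_apply (W₁ : LatticeWord k₀) (R : ℕ) (i : Fin k₀) (z : box R) (y : Space R) :
    linkBlock W₁ R i z y = transversalProj z.1
      (slotAmp W₁ i • transversalProj (z.1 - (W₁.phase i).m) (coordL R (z.1 - (W₁.phase i).m) y) +
        starRingEnd ℂ (slotAmp W₁ i) • transversalProj (z.1 + (W₁.phase i).m) (coordL R (z.1 + (W₁.phase i).m) y)) := by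
  simp only [linkBlock, ContinuousLinearMap.comp_apply, add_apply, smul_apply]

/-- **The unit-envelope link coefficient of slot `i` at `z`**: `−2πi (êᵢ·z)` (so that `linkCoeffᵢ(z,t) = −envᵢ(t)·hopCoeff`... precisely
`linkCoeff W₁ 1 z i t = −(slotEnvelope W₁ i t) • hopCoeff W₁ i z`, `linkCoeff_eq_neg_slotEnvelope_mul_hopCoeff`). [cite: MeshalkinSinai1961, pp. 1700–1705] -/
def hopCoeff (W₁ : LatticeWord k₀) (i : Fin k₀) (z : Fin 3 → ℤ) : ℂ := -(2 * Real.pi * Complex.I * (∑ a, ((W₁.phase i).e a : ℂ) * (z a)))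

/-- `linkCoeffᵢ(z,t) = −envᵢ(t) · hopCoeffᵢ(z)`. [cite: MeshalkinSinai1961, pp. 1700–1705] -/
theorem linkCoeff_eq_neg_slotEnvelope_mul_hopCoeff (W₁ : LatticeWord k₀) (z : Fin 3 → ℤ) (i : Fin k₀) (t : ℝ) :
    linkCoeff W₁ 1 z i t = -(((slotEnvelope W₁ i t : ℝ) : ℂ) * hopCoeff W₁ i z) := by
  rw [linkCoeff_eq, hopCoeff]
  push_cast
  ring

/-- **The link operator of slot `i` at unit envelope**, componentwise: `(hopL y)_z = hopCoeffᵢ(z) • linkBlockᵢ z y`.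
[cite: MeshalkinSinai1961, pp. 1700–1705] [cite: MajdaKramer1999, §2.2.1.3 (cell problem (49))] -/
def hopL (W₁ : LatticeWord k₀) (R : ℕ) (i : Fin k₀) : Space R →L[ℂ] Space R :=
  ((PiLp.continuousLinearEquiv 2 ℂ (fun _ : box R => EuclideanSpace ℂ (Fin 3))).symm :
      (box R → EuclideanSpace ℂ (Fin 3)) →L[ℂ] Space R).comp
    (ContinuousLinearMap.pi fun z : box R => hopCoeff W₁ i z.1 • linkBlock W₁ R i z)

/-- Components of `hopL`. [cite: MeshalkinSinai1961, pp. 1700–1705] -/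
theorem hopL_apply (W₁ : LatticeWord k₀) (R : ℕ) (i : Fin k₀) (y : Space R) (z : box R) :
    hopL W₁ R i y z = hopCoeff W₁ i z.1 • linkBlock W₁ R i z y := by
  simp [hopL]

/-- **The damping at the fibre `z`**: `y ↦ 4π² P_z T_{𝔸ᵀ}(z) P_z y_z + γ₁ (y_z − P_z y_z)` (`= −blockGen 𝔸 γ₁ z y_z`).
[cite: MajdaKramer1999, §2.2.1.3 (cell problem (49))] [cite: Frisch1995Turbulence, §9.6.3 eq. (9.57) p. 233] -/
def dampComp (𝔸 : Torus.Visc4 (Fin 3)) (γ₁ : ℝ) (R : ℕ) (z : box R) : Space R →L[ℂ] EuclideanSpace ℂ (Fin 3) :=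
  (((4 * Real.pi ^ 2 : ℝ) : ℂ)) • ((transversalProj z.1).comp ((symbTL (Torus.majorTranspose 𝔸) z.1).comp
      ((transversalProj z.1).comp (coordL R z.1)))) +
    ((γ₁ : ℝ) : ℂ) • (coordL R z.1 - (transversalProj z.1).comp (coordL R z.1))

/-- Unfolding `dampComp`. [cite: MajdaKramer1999, §2.2.1.3] -/
theorem dampComp_apply (𝔸 : Torus.Visc4 (Fin 3)) (γ₁ : ℝ) (R : ℕ) (z : box R) (y : Space R) :
    dampComp 𝔸 γ₁ R z y = (((4 * Real.pi ^ 2 : ℝ) : ℂ)) • transversalProj z.1 (Torus.symbT (Torus.majorTranspose 𝔸) z.1 (transversalProj z.1 (y z)))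
      + ((γ₁ : ℝ) : ℂ) • (y z - transversalProj z.1 (y z)) := by
  simp only [dampComp, add_apply, smul_apply, ContinuousLinearMap.comp_apply, sub_apply, symbTL_apply, coordL_coe_apply]

/-- **The damping operator** `dampL 𝔸 γ₁ R : Space R →L[ℂ] Space R` (components `dampComp`). [cite: MajdaKramer1999, §2.2.1.3] -/
def dampL (𝔸 : Torus.Visc4 (Fin 3)) (γ₁ : ℝ) (R : ℕ) : Space R →L[ℂ] Space R :=
  ((PiLp.continuousLinearEquiv 2 ℂ (fun _ : box R => EuclideanSpace ℂ (Fin 3))).symm :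
      (box R → EuclideanSpace ℂ (Fin 3)) →L[ℂ] Space R).comp
    (ContinuousLinearMap.pi fun z : box R => dampComp 𝔸 γ₁ R z)

/-- Components of `dampL`. [cite: MajdaKramer1999, §2.2.1.3] -/
theorem dampL_apply (𝔸 : Torus.Visc4 (Fin 3)) (γ₁ : ℝ) (R : ℕ) (y : Space R) (z : box R) : dampL 𝔸 γ₁ R y z = dampComp 𝔸 γ₁ R z y := by
  simp [dampL]

/-- `dampL` is `−blockGen` fibrewise. [cite: MajdaKramer1999, §2.2.1.3] -/
theorem dampL_apply_eq_neg_blockGen (𝔸 : Torus.Visc4 (Fin 3)) (γ₁ : ℝ) (R : ℕ) (y : Space R) (z : box R) :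
    dampL 𝔸 γ₁ R y z = -blockGen 𝔸 γ₁ z.1 (y z) := by
  rw [dampL_apply, dampComp_apply, blockGen_apply]
  simp only [neg_sub, sub_neg_eq_add, smul_sub]
  abel

/-! ## §3 The slot identity `gen = env • hopL − dampL` -/

/-- **THE SLOT IDENTITY**, componentwise: if the envelopes of all slots other than `i` vanish at `t`, then for every state `y` and retained `z`,
`(gen t y)_z = envᵢ(t) • (hopL y)_z − (dampL y)_z`. [cite: MajdaKramer1999, §2.2.1.3 (cell problem (49))] [cite: MeshalkinSinai1961, pp. 1700–1705] -/
theorem gen_apply_eq_of_slot (W₁ : LatticeWord k₀) (𝔸 : Torus.Visc4 (Fin 3)) (γ₁ : ℝ) (R : ℕ) (i : Fin k₀) {t : ℝ}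
    (hoff : ∀ j, j ≠ i → slotEnvelope W₁ j t = 0) (y : Space R) (z : box R) :
    gen W₁ 𝔸 γ₁ R t y z = ((slotEnvelope W₁ i t : ℝ) : ℂ) • hopL W₁ R i y z - dampL 𝔸 γ₁ R y z := by
  rw [gen_apply, genComp_apply, hopL_apply, dampL_apply, dampComp_apply, linkBlock_apply, coordL_coe_apply,
    Finset.sum_eq_single i (fun j _ hj => by rw [linkCoeff_eq_zero_of_slotEnvelope W₁ z.1 (hoff j hj), zero_smul])
      (fun h => absurd (Finset.mem_univ i) h),
    linkCoeff_eq_neg_slotEnvelope_mul_hopCoeff, smul_smul]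
  simp only [neg_smul, sub_neg_eq_add, smul_sub]
  abel

/-- **THE SLOT IDENTITY** as operators: `gen t = envᵢ(t) • hopL − dampL` whenever all other envelopes vanish at `t`.
[cite: MajdaKramer1999, §2.2.1.3 (cell problem (49))] -/
theorem gen_eq_of_slot (W₁ : LatticeWord k₀) (𝔸 : Torus.Visc4 (Fin 3)) (γ₁ : ℝ) (R : ℕ) (i : Fin k₀) {t : ℝ}
    (hoff : ∀ j, j ≠ i → slotEnvelope W₁ j t = 0) :
    gen W₁ 𝔸 γ₁ R t = ((slotEnvelope W₁ i t : ℝ) : ℂ) • hopL W₁ R i - dampL 𝔸 γ₁ R := by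
  ext y z : 2
  rw [gen_apply_eq_of_slot W₁ 𝔸 γ₁ R i hoff y z, sub_apply, smul_apply]
  rfl

/-! ## §4 Ladders and the ladder subspace -/

/-- **The `m`-ladder through `z₀`**: `{z₀ + k•m : k ∈ ℤ}`. [cite: MeshalkinSinai1961, pp. 1700–1705] -/
def ladder (z₀ m : Fin 3 → ℤ) : Set (Fin 3 → ℤ) := {z | ∃ k : ℤ, z = z₀ + k • m}

/-- Membership in a ladder. [cite: MeshalkinSinai1961, pp. 1700–1705] -/
theorem mem_ladder {z₀ m z : Fin 3 → ℤ} : z ∈ ladder z₀ m ↔ ∃ k : ℤ, z = z₀ + k • m := Iff.rfl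

/-- The base point is on its ladder. [cite: MeshalkinSinai1961, pp. 1700–1705] -/
theorem self_mem_ladder (z₀ m : Fin 3 → ℤ) : z₀ ∈ ladder z₀ m := ⟨0, by simp⟩

/-- Ladders are closed under `+m`. [cite: MeshalkinSinai1961, pp. 1700–1705] -/
theorem add_mem_ladder {z₀ m z : Fin 3 → ℤ} (hz : z ∈ ladder z₀ m) : z + m ∈ ladder z₀ m := by
  obtain ⟨k, rfl⟩ := hz
  exact ⟨k + 1, by rw [add_smul, one_smul, add_assoc]⟩

/-- Ladders are closed under `−m`. [cite: MeshalkinSinai1961, pp. 1700–1705] -/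
theorem sub_mem_ladder {z₀ m z : Fin 3 → ℤ} (hz : z ∈ ladder z₀ m) : z - m ∈ ladder z₀ m := by
  obtain ⟨k, rfl⟩ := hz
  exact ⟨k - 1, by rw [sub_smul, one_smul, add_sub_assoc]⟩

/-- `z ∈ ladder` iff `z + m ∈ ladder`. [cite: MeshalkinSinai1961, pp. 1700–1705] -/
theorem add_mem_ladder_iff {z₀ m z : Fin 3 → ℤ} : z + m ∈ ladder z₀ m ↔ z ∈ ladder z₀ m :=
  ⟨fun h => by simpa using sub_mem_ladder h, add_mem_ladder⟩

/-- `z ∈ ladder` iff `z − m ∈ ladder`. [cite: MeshalkinSinai1961, pp. 1700–1705] -/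
theorem sub_mem_ladder_iff {z₀ m z : Fin 3 → ℤ} : z - m ∈ ladder z₀ m ↔ z ∈ ladder z₀ m :=
  ⟨fun h => by simpa using add_mem_ladder h, sub_mem_ladder⟩

/-- **The ladder subspace**: the REAL subspace of `Space R` of states that are TRANSVERSAL (`z · y_z = 0`) and supported on the set `L` of lattice points
(the `V` of `LadderCrush.hypocoercive_decay'`; typically `L = ladder z₀ mᵢ`). [cite: MajdaKramer1999, §2.2.1.3 (cell problem (49))] -/
def ladderSub (R : ℕ) (L : Set (Fin 3 → ℤ)) : Submodule ℝ (Space R) where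
  carrier := {y | ∀ z : box R, (z.1 ∉ L → y z = 0) ∧ kdot z.1 (y z) = 0}
  add_mem' := by
    intro a b ha hb z
    refine ⟨fun hz => ?_, ?_⟩
    · rw [PiLp.add_apply, (ha z).1 hz, (hb z).1 hz, add_zero]
    · rw [PiLp.add_apply, map_add, (ha z).2, (hb z).2, add_zero]
  zero_mem' := fun z => ⟨fun _ => rfl, by simp⟩
  smul_mem' := by
    intro c y hy z
    refine ⟨fun hz => ?_, ?_⟩
    · rw [PiLp.smul_apply, (hy z).1 hz, smul_zero]
    · rw [PiLp.smul_apply, RCLike.real_smul_eq_coe_smul (K := ℂ), map_smul, (hy z).2, smul_zero]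

/-- Membership in the ladder subspace. [cite: MajdaKramer1999, §2.2.1.3] -/
theorem mem_ladderSub {R : ℕ} {L : Set (Fin 3 → ℤ)} {y : Space R} :
    y ∈ ladderSub R L ↔ ∀ z : box R, (z.1 ∉ L → y z = 0) ∧ kdot z.1 (y z) = 0 := Iff.rfl

/-- States of the ladder subspace vanish off `L`. [cite: MajdaKramer1999, §2.2.1.3] -/
theorem apply_eq_zero_of_mem_ladderSub {R : ℕ} {L : Set (Fin 3 → ℤ)} {y : Space R} (hy : y ∈ ladderSub R L) {z : box R} (hz : z.1 ∉ L) :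
    y z = 0 := ((mem_ladderSub.1 hy) z).1 hz

/-- States of the ladder subspace are transversal. [cite: MajdaKramer1999, §2.2.1.3] -/
theorem kdot_eq_zero_of_mem_ladderSub {R : ℕ} {L : Set (Fin 3 → ℤ)} {y : Space R} (hy : y ∈ ladderSub R L) (z : box R) :
    kdot z.1 (y z) = 0 := ((mem_ladderSub.1 hy) z).2

/-- On the ladder subspace every fibre is fixed by its Leray projection. [cite: Temam1984, Ch. III §1.1] -/
theorem transversalProj_apply_of_mem_ladderSub {R : ℕ} {L : Set (Fin 3 → ℤ)} {y : Space R} (hy : y ∈ ladderSub R L) (z : box R) :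
    transversalProj z.1 (y z) = y z :=
  transversalProj_eq_self_of_kdot_eq_zero z.1 (kdot_eq_zero_of_mem_ladderSub hy z)

end Summit.AnomalousDissipation.AnomalousDissipation.Theorems.SolenoidalFractalHomogenisation.LagrangianStep.Sideband

end
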